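import Literature.Analysis.FluidPDE.CKNEpsilonRegularityForce
import HarnessLib

/-!
# Lemarié-Rieusset's Thm. 14.4 at unit scale: reduction to the local pressure estimate

Analysis/FluidPDE proof file (no definitions, no named facts) for the named fact
`Literature.Analysis.FluidPDE.lemarieRieusset_epsilon_regularity_unitScale`
(`CKNEpsilonRegularityProofs.lean`: Lemarié-Rieusset, *The Navier–Stokes Problem in the 21st
Century*, §14.3, Thm. 14.4 — the Caffarelli–Kohn–Nirenberg ε-regularity criterion at one scale
with a force `f ∈ L^q_t L^q_x`, `q > 5/2` — in its normalised case `r₀ = 1`, `(t₀, x₀) = (0, 0)`).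

The tree already contains the whole reduction of Thm. 14.4 to Robinson–Rodrigo–Sadowski's local
pressure estimate (Lemma 15.12, the named fact `RRS2016.lemma15_12` of `CKNLocalRegularityRRS`):

* `lemarieRieusset_epsilon_regularity_of_lemma15_12` (`CKNEpsilonRegularityForce`) — Thm. 14.4
  for all viscosities, scales and centres and a general (non-solenoidal) force, from
  `RRS2016.lemma15_12` alone (Steps 1–4 of the Caffarelli–Kohn–Nirenberg /
  Robinson–Rodrigo–Sadowski induction, the cut-offs of Lemma 15.11, the Helmholtz absorption of
  the gradient part of the force and the viscosity normalisation being proved there and in its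
  imports);
* `lemarieRieusset_epsilon_regularity_iff_unitScale` (`CKNEpsilonRegularityProofs`) — Thm. 14.4
  is equivalent to its unit-scale case by the Navier–Stokes scaling.

This file records the composite,
`lemarieRieusset_epsilon_regularity_unitScale_of_lemma15_12 : RRS2016.lemma15_12 →
lemarieRieusset_epsilon_regularity_unitScale`, so that the discharge
`lemarieRieusset_epsilon_regularity_unitScale_holds` is immediate once `RRS2016.lemma15_12` is
proved. (It cannot be placed in `CKNEpsilonRegularityProofs.lean` itself, which is imported by
`CKNEpsilonRegularityForce` through `CKNEpsilonRegularityDivFree` and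
`CKNLocalRegularityRRSGlueLR`.)

## References

* P. G. Lemarié-Rieusset, *The Navier–Stokes Problem in the 21st Century*, 2nd ed., CRC Press,
  §14.3, Thm. 14.4 (scan p. 505). [Lemarierieusset2023]; 1st ed. (2016) [LemarieRieusset2016]
* J. C. Robinson, J. L. Rodrigo, W. Sadowski, *The three-dimensional Navier–Stokes equations*,
  CUP (2016), Thm. 15.3 and Lemma 15.12 (p. 232). [RobinsonRodrigoSadowski2016]
* L. Caffarelli, R. Kohn, L. Nirenberg, *Partial regularity of suitable weak solutions of the
  Navier–Stokes equations*, Comm. Pure Appl. Math. 35 (1982), 771–831, Proposition 1.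
  [CaffarelliKohnNirenberg1982]
-/

noncomputable section

namespace Literature.Analysis.FluidPDE

/-- **Thm. 14.4 at unit scale from the local pressure estimate.** Lemarié-Rieusset's Thm. 14.4
in the case `r₀ = 1`, `(t₀, x₀) = (0, 0)` (`lemarieRieusset_epsilon_regularity_unitScale`)
follows from Robinson–Rodrigo–Sadowski's Lemma 15.12 (`RRS2016.lemma15_12`): the accepted
`lemarieRieusset_epsilon_regularity_of_lemma15_12` gives Thm. 14.4 at all scales, and the
accepted scale invariance `lemarieRieusset_epsilon_regularity_iff_unitScale` specialises it.
[cite: Lemarierieusset2023, §14.3 Thm. 14.4 (scan p. 505), case r₀ = 1] -/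
theorem lemarieRieusset_epsilon_regularity_unitScale_of_lemma15_12 (h12 : RRS2016.lemma15_12) :
    lemarieRieusset_epsilon_regularity_unitScale :=
  lemarieRieusset_epsilon_regularity_iff_unitScale.mp
    (lemarieRieusset_epsilon_regularity_of_lemma15_12 h12)

end Literature.Analysis.FluidPDE

end
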